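import Summits.MatrixMultiplication.OmegaCensus.STPPSmallPatternCyclicThreeAPFree
import Mathlib.Analysis.SpecialFunctions.Pow.Real

/-!
# ω-census, small patterns: the Behrend form typed as a DENSITY law — `T1(ℤ/m), T2(ℤ/m), n(ℤ/m) ≥ (m/c)^{1−ε}` eventually

Cell `pub-omega`, ω construction census, seat pub-omega ENG2 (gen 33). HONEST FRAMING (verbatim): lottery ticket; floor =
certified bounds/negative ranges.  Census STRUCTURE bookkeeping for column B5 / question Q7 (cyclic host counts of the patterns
`(2,1,1)^k`, `(1,2,2)^k`, `(2,2,2)^k`); nothing here bears on `ω`.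

The Behrend forms in the tree (`exists_isSTPP_211pow_zmod_behrend`, `exists_isSTPP_122pow_zmod_behrend` — gen 33's
`STPPSmallPatternCyclicThreeAPFree.lean`; `exists_isSTPP_222pow_zmod_behrend` — stpp-3's `STPP222PowCyclicThreeAPFree.lean`) read
"for every `N` and every `m ≥ 4N − 2` (resp. `8N − 4`, `16N − 8`) some `k ≥ N·e^{−4√(log N)}` triples fit in `ℤ/m`", with Mathlib's
`Behrend.roth_lower_bound`.  The census gloss "`m^{1−o(1)}`" was so far a paper remark; this file types it with its quantifiers:

* `rpow_one_sub_le_behrend` — the calculus step: for every `ε > 0` there is `N₀` with `N^{1−ε} ≤ N·e^{−4√(log N)}` for all `N ≥ N₀`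
  (take `log N ≥ 16/ε²`, so that `4√(log N) ≤ ε·log N`);
* `exists_isSTPP_211pow_zmod_density` — **for every `ε > 0` there is `N₀` such that for all `N ≥ N₀` and all `m ≥ 4N − 2` the cyclic
  group `ℤ/m` hosts `(2,1,1)^k` for some `k ≥ N^{1−ε}`**; `…122pow…` (`m ≥ 8N − 4`) and `…222pow…` (`m ≥ 16N − 8`) likewise;
* `exists_isSTPP_211pow_zmod_density'` etc. — the same read at `N = ⌊(m+2)/4⌋` (resp. `⌊(m+4)/8⌋`, `⌊(m+8)/16⌋`): **for every `ε > 0`,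
  every sufficiently large `m` has `T1(ℤ/m) ≥ ⌊(m+2)/4⌋^{1−ε}`, `T2(ℤ/m) ≥ ⌊(m+4)/8⌋^{1−ε}`, `n(ℤ/m) ≥ ⌊(m+8)/16⌋^{1−ε}`.**

So the linear packing laws (`4k ≤ m + 2`, `6k ≤ m + 2`, `8k ≤ m + 4`) are sharp up to a factor `m^{ε}` for every `ε > 0` along ALL
moduli, while the count is `o(m)` (`exists_lt_card_of_isSTPP`, `STPPCountSublinear.lean`).  No rate beyond Behrend's is claimed.

References: F. Behrend, Proc. Nat. Acad. Sci. 32 (1946) 331–332 (via Mathlib `Behrend.roth_lower_bound`); H. Cohn, R. Kleinberg,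
B. Szegedy, C. Umans, FOCS 2005 (arXiv:math/0511460), Def. 5.1.  Seat pub-omega ENG2 (gen 33), 2026-08-28.
-/

open Literature.Computability.AlgebraicComplexity Finset

namespace Summit.MatrixMultiplication.OmegaCensus

/-! ## The calculus step -/

/-- For every `ε > 0`: `N^{1−ε} ≤ N · e^{−4√(log N)}` for all `N ≥ N₀(ε)` (any `N` with `log N ≥ 16/ε²` will do, since then
`4√(log N) ≤ ε log N`). [folklore] -/
theorem rpow_one_sub_le_behrend {ε : ℝ} (hε : 0 < ε) :
    ∃ N₀ : ℕ, ∀ N : ℕ, N₀ ≤ N → (N : ℝ) ^ (1 - ε) ≤ (N : ℝ) * Real.exp (-4 * √(Real.log N)) := by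
  refine ⟨⌈Real.exp (16 / ε ^ 2)⌉₊ + 1, fun N hN => ?_⟩
  have hN1 : (1 : ℝ) ≤ N := by exact_mod_cast (show 1 ≤ N by omega)
  have hNpos : (0 : ℝ) < N := by linarith
  have hexp : Real.exp (16 / ε ^ 2) ≤ N := by
    have h1 : Real.exp (16 / ε ^ 2) ≤ ⌈Real.exp (16 / ε ^ 2)⌉₊ := Nat.le_ceil _
    have h2 : (⌈Real.exp (16 / ε ^ 2)⌉₊ : ℝ) ≤ N := by
      exact_mod_cast (show ⌈Real.exp (16 / ε ^ 2)⌉₊ ≤ N by omega)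
    linarith
  have hlog : 16 / ε ^ 2 ≤ Real.log N := (Real.le_log_iff_exp_le hNpos).2 hexp
  have hlog0 : 0 ≤ Real.log N := Real.log_nonneg hN1
  have hsqrt : 4 / ε ≤ √(Real.log N) := by
    rw [Real.le_sqrt (by positivity) hlog0]
    calc (4 / ε) ^ 2 = 16 / ε ^ 2 := by ring
      _ ≤ Real.log N := hlog
  have h4 : 4 ≤ ε * √(Real.log N) := by
    have := mul_le_mul_of_nonneg_left hsqrt hε.le
    rwa [mul_div_cancel₀ (4 : ℝ) hε.ne'] at this
  have hkey : 4 * √(Real.log N) ≤ ε * Real.log N := by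
    calc 4 * √(Real.log N) ≤ (ε * √(Real.log N)) * √(Real.log N) :=
          mul_le_mul_of_nonneg_right h4 (Real.sqrt_nonneg _)
      _ = ε * Real.log N := by rw [mul_assoc, Real.mul_self_sqrt hlog0]
  rw [Real.rpow_def_of_pos hNpos, show Real.log N * (1 - ε) = Real.log N + -(ε * Real.log N) by ring, Real.exp_add,
    Real.exp_log hNpos]
  exact mul_le_mul_of_nonneg_left (Real.exp_le_exp.2 (by linarith)) hNpos.le

/-! ## Density laws for the three patterns -/

/-- **`T1(ℤ/m) ≥ N^{1−ε}`**: for every `ε > 0` there is `N₀` such that for all `N ≥ N₀` and all `m ≥ 4N − 2`, some `k ≥ N^{1−ε}`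
has `(2,1,1)^k ⊆ ℤ/m`. [cite: CohnKleinbergSzegedyUmans2005, Def. 5.1] -/
theorem exists_isSTPP_211pow_zmod_density {ε : ℝ} (hε : 0 < ε) :
    ∃ N₀ : ℕ, ∀ N : ℕ, N₀ ≤ N → ∀ m : ℕ, 4 * N ≤ m + 2 →
      ∃ k : ℕ, (N : ℝ) ^ (1 - ε) ≤ k ∧
        ∃ A B C : Fin k → Finset (ZMod m), IsSTPP A B C ∧ ∀ i, (A i).card = 2 ∧ (B i).card = 1 ∧ (C i).card = 1 := by
  obtain ⟨N₀, hN₀⟩ := rpow_one_sub_le_behrend hε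
  refine ⟨N₀, fun N hN m hm => ?_⟩
  obtain ⟨k, hk, h⟩ := exists_isSTPP_211pow_zmod_behrend N m hm
  exact ⟨k, (hN₀ N hN).trans hk, h⟩

/-- **`T2(ℤ/m) ≥ N^{1−ε}`**: for every `ε > 0` there is `N₀` such that for all `N ≥ N₀` and all `m ≥ 8N − 4`, some `k ≥ N^{1−ε}`
has `(1,2,2)^k ⊆ ℤ/m`. [cite: CohnKleinbergSzegedyUmans2005, Def. 5.1] -/
theorem exists_isSTPP_122pow_zmod_density {ε : ℝ} (hε : 0 < ε) :
    ∃ N₀ : ℕ, ∀ N : ℕ, N₀ ≤ N → ∀ m : ℕ, 8 * N ≤ m + 4 →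
      ∃ k : ℕ, (N : ℝ) ^ (1 - ε) ≤ k ∧
        ∃ A B C : Fin k → Finset (ZMod m), IsSTPP A B C ∧ ∀ i, (A i).card = 1 ∧ (B i).card = 2 ∧ (C i).card = 2 := by
  obtain ⟨N₀, hN₀⟩ := rpow_one_sub_le_behrend hε
  refine ⟨N₀, fun N hN m hm => ?_⟩
  obtain ⟨k, hk, h⟩ := exists_isSTPP_122pow_zmod_behrend N m hm
  exact ⟨k, (hN₀ N hN).trans hk, h⟩

/-- **`n(ℤ/m) ≥ N^{1−ε}`** (pattern `(2,2,2)^k`, the tree's `exists_isSTPP_222pow_zmod_behrend`): for every `ε > 0` there is `N₀` such that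
for all `N ≥ N₀` and all `m ≥ 16N − 8`, some `k ≥ N^{1−ε}` has `(2,2,2)^k ⊆ ℤ/m`. [cite: CohnKleinbergSzegedyUmans2005, Def. 5.1] -/
theorem exists_isSTPP_222pow_zmod_density {ε : ℝ} (hε : 0 < ε) :
    ∃ N₀ : ℕ, ∀ N : ℕ, N₀ ≤ N → ∀ m : ℕ, 16 * N ≤ m + 8 →
      ∃ k : ℕ, (N : ℝ) ^ (1 - ε) ≤ k ∧
        ∃ A B C : Fin k → Finset (ZMod m), IsSTPP A B C ∧ ∀ i, (A i).card = 2 ∧ (B i).card = 2 ∧ (C i).card = 2 := by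
  obtain ⟨N₀, hN₀⟩ := rpow_one_sub_le_behrend hε
  refine ⟨N₀, fun N hN m hm => ?_⟩
  obtain ⟨k, hk, h⟩ := exists_isSTPP_222pow_zmod_behrend N m hm
  exact ⟨k, (hN₀ N hN).trans hk, h⟩

/-! ## The same, read along all moduli -/

/-- **`T1(ℤ/m) ≥ ⌊(m+2)/4⌋^{1−ε}` for all large `m`.** [cite: CohnKleinbergSzegedyUmans2005, Def. 5.1] -/
theorem exists_isSTPP_211pow_zmod_density' {ε : ℝ} (hε : 0 < ε) :
    ∃ m₀ : ℕ, ∀ m : ℕ, m₀ ≤ m →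
      ∃ k : ℕ, (((m + 2) / 4 : ℕ) : ℝ) ^ (1 - ε) ≤ k ∧
        ∃ A B C : Fin k → Finset (ZMod m), IsSTPP A B C ∧ ∀ i, (A i).card = 2 ∧ (B i).card = 1 ∧ (C i).card = 1 := by
  obtain ⟨N₀, hN₀⟩ := exists_isSTPP_211pow_zmod_density hε
  exact ⟨4 * N₀ + 2, fun m hm => hN₀ ((m + 2) / 4) (by omega) m (by omega)⟩

/-- **`T2(ℤ/m) ≥ ⌊(m+4)/8⌋^{1−ε}` for all large `m`.** [cite: CohnKleinbergSzegedyUmans2005, Def. 5.1] -/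
theorem exists_isSTPP_122pow_zmod_density' {ε : ℝ} (hε : 0 < ε) :
    ∃ m₀ : ℕ, ∀ m : ℕ, m₀ ≤ m →
      ∃ k : ℕ, (((m + 4) / 8 : ℕ) : ℝ) ^ (1 - ε) ≤ k ∧
        ∃ A B C : Fin k → Finset (ZMod m), IsSTPP A B C ∧ ∀ i, (A i).card = 1 ∧ (B i).card = 2 ∧ (C i).card = 2 := by
  obtain ⟨N₀, hN₀⟩ := exists_isSTPP_122pow_zmod_density hε
  exact ⟨8 * N₀ + 4, fun m hm => hN₀ ((m + 4) / 8) (by omega) m (by omega)⟩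

/-- **`n(ℤ/m) ≥ ⌊(m+8)/16⌋^{1−ε}` for all large `m`** (pattern `(2,2,2)^k`). [cite: CohnKleinbergSzegedyUmans2005, Def. 5.1] -/
theorem exists_isSTPP_222pow_zmod_density' {ε : ℝ} (hε : 0 < ε) :
    ∃ m₀ : ℕ, ∀ m : ℕ, m₀ ≤ m →
      ∃ k : ℕ, (((m + 8) / 16 : ℕ) : ℝ) ^ (1 - ε) ≤ k ∧
        ∃ A B C : Fin k → Finset (ZMod m), IsSTPP A B C ∧ ∀ i, (A i).card = 2 ∧ (B i).card = 2 ∧ (C i).card = 2 := by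
  obtain ⟨N₀, hN₀⟩ := exists_isSTPP_222pow_zmod_density hε
  exact ⟨16 * N₀ + 8, fun m hm => hN₀ ((m + 8) / 16) (by omega) m (by omega)⟩

end Summit.MatrixMultiplication.OmegaCensus
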